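import Summits.QuantumFields.YangMills.Theorems.LangevinControlUVOSLegsAtWeakCouplingCStubLocalitySemigroup
import Summits.QuantumFields.YangMills.Theorems.LangevinControlUVOSLegsAtWeakCouplingCDefs
import Literature.MathematicalPhysics.QuantumFieldTheory.OSReconstructionNoE1
import HarnessLib

/-!
# The one-slot Osterwalder–Schrader continuation of a one-field family on `⁰𝒮` (E1-locality toolkit II)

Helper file for stub `stub_locality` of crux `OSLegsAtWeakCouplingC` (stmt-QuantumFields-16207, line `Sketch`).
For a one-field family `S₁` on `⁰𝒮(ℝ⁴)` that is reflection positive on positive-time off-diagonal tuples (`RPPos`) and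
translation invariant on `⁰𝒮`, the tree's rotation-free reconstruction `OSReconstructionNoE1` (OS I §4.1) applies to
`S₁.toLabelled`: Hilbert space, field vectors `Ψ_F` of time-ordered `F`, the contraction semigroup `e^{-tH}`.  Here:

* `osRec` — the reconstruction data of `S₁`;
* `inner_fieldVec_transfer_fieldVec` — `⟪Ψ_X, e^{-tH} Ψ_U⟫ = S₁(ΘX* ⊗ T_t U)` (`t ≥ 0`), the two-cluster matrix element;
* `norm_fieldVec_sub_sq` — `‖Ψ_F − Ψ_G‖² = Re S₁(Θ(F−G)* ⊗ (F−G))` for time-ordered `F, G` of one arity (no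
  time-ordering of `F − G` needed), whence continuity of `F ↦ Ψ_F` along Schwartz-convergent families
  (`tendsto_fieldVec`);
* `exists_twoCluster_continuation` — with toolkit I (`exists_holomorphic_matrixElem`): the two-cluster functions
  `t ↦ S₁(ΘX* ⊗ T_t U)` are restrictions of one function `M (Ψ_X) (Ψ_U)` holomorphic on `{Re τ > 0}`, sesquilinear and
  Lipschitz in the field vectors, bounded by `2 ‖Ψ_X‖ ‖Ψ_U‖`.
-/

noncomputable section

open MeasureTheory Set Filter Complex
open _root_.Topology
open scoped InnerProductSpace ComplexConjugate SchwartzMap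
open Literature.MathematicalPhysics.QuantumFieldTheory Literature.MathematicalPhysics.QuantumLattice
open Literature.MathematicalPhysics.AQFT
open Summit.QuantumFields.YangMills.Cruxes.OSLegsFromFemtoAndGap.DlrCollarTransfer (RPPos isReflectionPositive_of_rpPos)

namespace Summit.QuantumFields.YangMills.Theorems.OSLegsAtWeakCouplingC

open Literature.Analysis.OperatorTheory
open Literature.MathematicalPhysics.QuantumLattice.SchwingerFamily (timeVec)

variable {S₁ : SchwingerFamily (EuclideanSpace ℝ (Fin 4))}

/-- **The rotation-free OS reconstruction data of a one-field family** with `RPPos` and translation invariance on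
`⁰𝒮`. -/
theorem osRec (hRP : RPPos S₁)
    (htrans : ∀ (n : ℕ) (t : (EuclideanSpace ℝ (Fin 4))) (F : 𝓢((Fin n → (EuclideanSpace ℝ (Fin 4))), ℂ)), IsOffDiagonal F → S₁ n (translateMulti t F) = S₁ n F) :
    OSReconstructionNoE1 S₁.toLabelled :=
  ⟨isReflectionPositive_of_rpPos hRP, fun n _ a F hF => htrans n a F hF⟩

section Vectors

variable (h : OSReconstructionNoE1 S₁.toLabelled)

/-- **The two-cluster matrix element**: `⟪Ψ_X, e^{-tH} Ψ_U⟫ = S₁_{a+b}(ΘX* ⊗ T_{t e₀} U)` for time-ordered `X, U` and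
`t ≥ 0`. -/
theorem inner_fieldVec_transfer_fieldVec {a b : ℕ} {X : 𝓢((Fin a → (EuclideanSpace ℝ (Fin 4))), ℂ)} {U : 𝓢((Fin b → (EuclideanSpace ℝ (Fin 4))), ℂ)}
    (hX : IsTimeOrdered X) (hU : IsTimeOrdered U) {t : ℝ} (ht : 0 ≤ t) :
    ⟪h.fieldVec a (fun _ => ()) X hX, h.transfer t (h.fieldVec b (fun _ => ()) U hU)⟫_ℂ =
      S₁ (a + b) ((osAdjoint X).appendTensor (translateMulti (timeVec t) U)) := by
  rw [h.transfer_fieldVec ht, h.inner_fieldVec_fieldVec (fun _ => ()) (fun _ => ()) hX _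
    (isAppendTensorOf_appendTensor _ _)]
  rfl

/-- `⟪Ψ_F, Ψ_G⟫ = S₁(ΘF* ⊗ G)`. -/
theorem inner_fieldVec_fieldVec_one {a b : ℕ} {F : 𝓢((Fin a → (EuclideanSpace ℝ (Fin 4))), ℂ)} {G : 𝓢((Fin b → (EuclideanSpace ℝ (Fin 4))), ℂ)}
    (hF : IsTimeOrdered F) (hG : IsTimeOrdered G) :
    ⟪h.fieldVec a (fun _ => ()) F hF, h.fieldVec b (fun _ => ()) G hG⟫_ℂ = S₁ (a + b) ((osAdjoint F).appendTensor G) := by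
  rw [h.inner_fieldVec_fieldVec (fun _ => ()) (fun _ => ()) hF hG (isAppendTensorOf_appendTensor _ _)]
  rfl

/-- **`‖Ψ_F − Ψ_G‖² = Re S₁(Θ(F−G)* ⊗ (F−G))`** for time-ordered `F, G` of the same arity (expand the square; the OS
pairing is sesquilinear in the test functions). -/
theorem norm_fieldVec_sub_sq {n : ℕ} {F G : 𝓢((Fin n → (EuclideanSpace ℝ (Fin 4))), ℂ)} (hF : IsTimeOrdered F) (hG : IsTimeOrdered G) :
    ‖h.fieldVec n (fun _ => ()) F hF - h.fieldVec n (fun _ => ()) G hG‖ ^ 2 =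
      (S₁ (n + n) ((osAdjoint (F - G)).appendTensor (F - G))).re := by
  set x := h.fieldVec n (fun _ => ()) F hF
  set y := h.fieldVec n (fun _ => ()) G hG
  have hxx : ⟪x, x⟫_ℂ = S₁ (n + n) ((osAdjoint F).appendTensor F) := inner_fieldVec_fieldVec_one h hF hF
  have hyy : ⟪y, y⟫_ℂ = S₁ (n + n) ((osAdjoint G).appendTensor G) := inner_fieldVec_fieldVec_one h hG hG
  have hxy : ⟪x, y⟫_ℂ = S₁ (n + n) ((osAdjoint F).appendTensor G) := inner_fieldVec_fieldVec_one h hF hG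
  have hyx : ⟪y, x⟫_ℂ = S₁ (n + n) ((osAdjoint G).appendTensor F) := inner_fieldVec_fieldVec_one h hG hF
  have hexp : (osAdjoint (F - G)).appendTensor (F - G) =
      (osAdjoint F).appendTensor F - (osAdjoint F).appendTensor G - (osAdjoint G).appendTensor F +
        (osAdjoint G).appendTensor G := by
    rw [osAdjoint_sub, SchwartzMap.appendTensor_sub_left, SchwartzMap.appendTensor_sub_right,
      SchwartzMap.appendTensor_sub_right]
    abel
  have h1 : ((‖x - y‖ ^ 2 : ℝ) : ℂ) = ⟪x - y, x - y⟫_ℂ := by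
    rw [inner_self_eq_norm_sq_to_K]; norm_cast
  have h2 : ⟪x - y, x - y⟫_ℂ = ⟪x, x⟫_ℂ - ⟪x, y⟫_ℂ - ⟪y, x⟫_ℂ + ⟪y, y⟫_ℂ := by
    simp only [inner_sub_left, inner_sub_right]; ring
  have h3 : ((‖x - y‖ ^ 2 : ℝ) : ℂ) = S₁ (n + n) ((osAdjoint (F - G)).appendTensor (F - G)) := by
    rw [h1, h2, hxx, hxy, hyx, hyy, hexp, map_add, map_sub, map_sub]
  have := congrArg Complex.re h3
  simpa [← Complex.ofReal_pow] using this

/-- `‖Ψ_F − Ψ_G‖ ≤ ‖S₁(Θ(F−G)* ⊗ (F−G))‖^{1/2}`. -/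
theorem norm_fieldVec_sub_le {n : ℕ} {F G : 𝓢((Fin n → (EuclideanSpace ℝ (Fin 4))), ℂ)} (hF : IsTimeOrdered F) (hG : IsTimeOrdered G) :
    ‖h.fieldVec n (fun _ => ()) F hF - h.fieldVec n (fun _ => ()) G hG‖ ≤
      Real.sqrt ‖S₁ (n + n) ((osAdjoint (F - G)).appendTensor (F - G))‖ := by
  rw [← Real.sqrt_sq (norm_nonneg _), norm_fieldVec_sub_sq h hF hG]
  exact Real.sqrt_le_sqrt (Complex.re_le_norm _)

/-- `‖Ψ_F‖² = Re S₁(ΘF* ⊗ F)`. -/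
theorem norm_fieldVec_sq {n : ℕ} {F : 𝓢((Fin n → (EuclideanSpace ℝ (Fin 4))), ℂ)} (hF : IsTimeOrdered F) :
    ‖h.fieldVec n (fun _ => ()) F hF‖ ^ 2 = (S₁ (n + n) ((osAdjoint F).appendTensor F)).re := by
  have h1 : ((‖h.fieldVec n (fun _ => ()) F hF‖ ^ 2 : ℝ) : ℂ) = S₁ (n + n) ((osAdjoint F).appendTensor F) := by
    rw [← inner_fieldVec_fieldVec_one h hF hF, inner_self_eq_norm_sq_to_K]; norm_cast
  have := congrArg Complex.re h1
  simpa [← Complex.ofReal_pow] using this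

/-- `‖Ψ_F‖ ≤ ‖S₁(ΘF* ⊗ F)‖^{1/2}`. -/
theorem norm_fieldVec_le {n : ℕ} {F : 𝓢((Fin n → (EuclideanSpace ℝ (Fin 4))), ℂ)} (hF : IsTimeOrdered F) :
    ‖h.fieldVec n (fun _ => ()) F hF‖ ≤ Real.sqrt ‖S₁ (n + n) ((osAdjoint F).appendTensor F)‖ := by
  rw [← Real.sqrt_sq (norm_nonneg _), norm_fieldVec_sq h hF]
  exact Real.sqrt_le_sqrt (Complex.re_le_norm _)

/-- **Continuity of `F ↦ Ψ_F` along Schwartz-convergent families of time-ordered functions.** -/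
theorem tendsto_fieldVec {α : Type*} {l : Filter α} {n : ℕ} {P : α → 𝓢((Fin n → (EuclideanSpace ℝ (Fin 4))), ℂ)} (hP : ∀ i, IsTimeOrdered (P i))
    {F : 𝓢((Fin n → (EuclideanSpace ℝ (Fin 4))), ℂ)} (hF : IsTimeOrdered F) (hlim : Tendsto P l (𝓝 F)) :
    Tendsto (fun i => h.fieldVec n (fun _ => ()) (P i) (hP i)) l (𝓝 (h.fieldVec n (fun _ => ()) F hF)) := by
  rw [tendsto_iff_norm_sub_tendsto_zero]
  have hsub : Tendsto (fun i => P i - F) l (𝓝 0) := by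
    simpa using hlim.sub_const F
  have hten : Tendsto (fun i => (osAdjoint (P i - F)).appendTensor (P i - F)) l
      (𝓝 ((osAdjoint (0 : 𝓢((Fin n → (EuclideanSpace ℝ (Fin 4))), ℂ))).appendTensor 0)) :=
    SchwartzMap.tendsto_appendTensor ((continuous_osAdjoint.tendsto _).comp hsub) hsub
  have hS : Tendsto (fun i => S₁ (n + n) ((osAdjoint (P i - F)).appendTensor (P i - F))) l (𝓝 0) := by
    have h0 : S₁ (n + n) ((osAdjoint (0 : 𝓢((Fin n → (EuclideanSpace ℝ (Fin 4))), ℂ))).appendTensor 0) = 0 := by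
      have : (osAdjoint (0 : 𝓢((Fin n → (EuclideanSpace ℝ (Fin 4))), ℂ))).appendTensor (0 : 𝓢((Fin n → (EuclideanSpace ℝ (Fin 4))), ℂ)) = 0 := by
        ext x; simp
      rw [this, map_zero]
    have h1 := ((S₁ (n + n)).continuous.tendsto _).comp hten
    rw [h0] at h1
    exact h1
  have hsq : Tendsto (fun i => Real.sqrt ‖S₁ (n + n) ((osAdjoint (P i - F)).appendTensor (P i - F))‖) l (𝓝 0) := by
    have h1 := (Real.continuous_sqrt.tendsto 0).comp (tendsto_zero_iff_norm_tendsto_zero.1 hS)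
    rw [Real.sqrt_zero] at h1
    exact h1
  exact squeeze_zero (fun i => norm_nonneg _) (fun i => norm_fieldVec_sub_le h (hP i) hF) hsq

end Vectors

/-- **The two-cluster continuation of a one-field family** (one slot).  For `S₁` with `RPPos` and translation
invariance on `⁰𝒮` (reconstruction data `h`): there is `M` on the OS Hilbert space, holomorphic in `τ` on `{Re τ > 0}`,
sesquilinear and Lipschitz in the vectors with `|M x y τ| ≤ 2‖x‖‖y‖`, whose values on field vectors at real `t > 0`
are the two-cluster Schwinger functions: `M Ψ_X Ψ_U t = S₁_{a+b}(ΘX* ⊗ T_{t e₀} U)` (time-ordered `X, U`). -/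
theorem exists_twoCluster_continuation (h : OSReconstructionNoE1 S₁.toLabelled) : ∃ M : h.Hilbert → h.Hilbert → ℂ → ℂ, (∀ (a b : ℕ) (X : 𝓢((Fin a → (EuclideanSpace ℝ (Fin 4))), ℂ)) (U : 𝓢((Fin b → (EuclideanSpace ℝ (Fin 4))), ℂ)) (hX : IsTimeOrdered X) (hU : IsTimeOrdered U) (t : ℝ), 0 < t → M (h.fieldVec a (fun _ => ()) X hX) (h.fieldVec b (fun _ => ()) U hU) t = S₁ (a + b) ((osAdjoint X).appendTensor (translateMulti (timeVec t) U))) ∧ (∀ x y : h.Hilbert, DifferentiableOn ℂ (M x y) {τ : ℂ | 0 < τ.re}) ∧ (∀ τ : ℂ, 0 < τ.re → IsSesqForm fun x y => M x y τ) ∧ (∀ (x y : h.Hilbert) (τ : ℂ), 0 < τ.re → ‖M x y τ‖ ≤ 2 * ‖x‖ * ‖y‖) ∧ (∀ (x x' y y' : h.Hilbert) (τ : ℂ), 0 < τ.re → ‖M x y τ - M x' y' τ‖ ≤ 2 * ‖x - x'‖ * ‖y‖ + 2 * ‖x'‖ * ‖y - y'‖) := by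
  obtain ⟨M, hreal, hholo, hsesq, hbd, hlip⟩ := exists_holomorphic_matrixElem h.transfer
    (fun s t hs ht => by rw [h.transfer_add hs.le ht.le]; rfl) (fun t _ => h.isSelfAdjoint_transfer t)
    (fun t _ => h.opNorm_transfer_le t)
  refine ⟨M, fun a b X U hX hU t ht => ?_, hholo, hsesq, hbd, hlip⟩
  rw [hreal _ _ t ht, inner_fieldVec_transfer_fieldVec h hX hU ht.le]

end Summit.QuantumFields.YangMills.Theorems.OSLegsAtWeakCouplingC

end
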